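import Summits.AtomisticToContinuum.BoseEinsteinCondensation.Theorems.BECSwapNoCatastropheTorusHalfSwapOverlapSwapInvariance
import Literature.MathematicalPhysics.QuantumManyBody.BoseGasProductState
import Literature.MathematicalPhysics.QuantumManyBody.PeriodicBoseGasTagged
import HarnessLib

/-!
# Crux `TorusHalfSwapOverlap` (stmt-AtomisticToContinuum-14393), line `birth`: stub `stub_appendEmbedding` (S5a)

Route `BECSwapNoCatastrophe` (sub-problem `BoseEinsteinCondensation`), lead c5 (2026-08-17). Fixed-`n` EMBEDDING: a periodic
`(n+1)+(n+1)`-particle trial state `Ξ` on the torus of side `L`, read as the two-copy function `Θ (X, Y) = Ξ (Fin.append X Y)`,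
is absolutely admissible on `cell² = cellN (n+1) L ×ˢ cellN (n+1) L` (`C¹`, `Lℤ³`-periodic in every coordinate of both copies,
normalised) and its half-swapped and uncoupled two-copy energies are at most `periodicEnergy v Ξ`: the two-copy kinetic
density at `(X, Y)` IS the full kinetic density of `Ξ` at `Fin.append X Y`, the two weights are SUB-sums of the full pair
interaction of the `2(n+1)` particles (coefficients `½ ≤ 1`; `v^per` is even, `periodizedPotential_sub_comm`), and
`(X, Y) ↦ Fin.append X Y` is a measure-preserving measurable equivalence (`splitConfig`⁻¹ of `BoseGasProductState`) mapping
`cell²` onto `cellN ((n+1)+(n+1)) L`. Consumed by `stub_nonVacuity` (non-vacuity of the near-minimiser frames). [folklore]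
-/

noncomputable section

open MeasureTheory Filter
open scoped ENNReal NNReal BigOperators ComplexConjugate

namespace Summit.AtomisticToContinuum.BoseEinsteinCondensation.Cruxes.TorusHalfSwapOverlap.Birth

open Literature.MathematicalPhysics.QuantumManyBody.BoseGas

namespace AppendEmbedding

variable {n₁ n₂ : ℕ}

/-! #### Index bookkeeping on `Fin (n₁ + n₂)` -/

/-- A first-block index precedes every second-block index. [folklore] -/
theorem castAdd_lt_natAdd (i : Fin n₁) (j : Fin n₂) : Fin.castAdd n₂ i < Fin.natAdd n₁ j := by
  rw [Fin.lt_def, Fin.val_castAdd, Fin.val_natAdd]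
  omega

/-- No second-block index precedes a first-block index. [folklore] -/
theorem not_natAdd_lt_castAdd (i : Fin n₁) (j : Fin n₂) : ¬Fin.natAdd n₁ j < Fin.castAdd n₂ i :=
  not_lt.mpr (castAdd_lt_natAdd i j).le

/-- Second-block and first-block indices differ. [folklore] -/
theorem natAdd_ne_castAdd (i : Fin n₁) (j : Fin n₂) : Fin.natAdd n₁ j ≠ Fin.castAdd n₂ i :=
  (castAdd_lt_natAdd i j).ne'

/-! #### `Fin.append` is linear; its action on the coordinate directions -/

/-- `Fin.append` is additive in the pair. [folklore] -/
theorem append_add (X X' : Config n₁) (Y Y' : Config n₂) :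
    Fin.append (X + X') (Y + Y') = Fin.append X Y + Fin.append X' Y' := by
  funext p
  refine Fin.addCases (fun i => ?_) (fun j => ?_) p
  · simp only [Fin.append_left, Pi.add_apply]
  · simp only [Fin.append_right, Pi.add_apply]

/-- `Fin.append` is homogeneous in the pair. [folklore] -/
theorem append_smul (c : ℝ) (X : Config n₁) (Y : Config n₂) :
    Fin.append (c • X) (c • Y) = c • Fin.append X Y := by
  funext p
  refine Fin.addCases (fun i => ?_) (fun j => ?_) p
  · simp only [Fin.append_left, Pi.smul_apply]
  · simp only [Fin.append_right, Pi.smul_apply]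

/-- Juxtaposition `(X, Y) ↦ Fin.append X Y` is (the underlying map of) a continuous linear map
`(ℝ³)^{n₁} × (ℝ³)^{n₂} →L (ℝ³)^{n₁+n₂}`. [folklore] -/
theorem exists_appendCLM (n₁ n₂ : ℕ) :
    ∃ A : (Config n₁ × Config n₂) →L[ℝ] Config (n₁ + n₂), ∀ Z, A Z = Fin.append Z.1 Z.2 :=
  ⟨LinearMap.toContinuousLinearMap
    { toFun := fun Z => Fin.append Z.1 Z.2
      map_add' := fun Z W => append_add Z.1 W.1 Z.2 W.2
      map_smul' := fun c Z => append_smul c Z.1 Z.2 }, fun _ => rfl⟩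

/-- Through a juxtaposition CLM `A`, `(X, Y) ↦ ψ (Fin.append X Y)` is `ψ ∘ A`. [folklore] -/
theorem comp_append_eq {A : (Config n₁ × Config n₂) →L[ℝ] Config (n₁ + n₂)} (hA : ∀ Z, A Z = Fin.append Z.1 Z.2)
    (ψ : Config (n₁ + n₂) → ℂ) : (fun W : Config n₁ × Config n₂ => ψ (Fin.append W.1 W.2)) = ψ ∘ A :=
  funext fun W => by rw [Function.comp_apply, hA]

/-- A first-copy direction: `Fin.append (e_i ⊗ u) 0 = e_{castAdd i} ⊗ u`. [folklore] -/
theorem append_single_zero (i : Fin n₁) (u : Space) :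
    Fin.append (Pi.single i u) (0 : Config n₂) = (Pi.single (Fin.castAdd n₂ i) u : Config (n₁ + n₂)) := by
  funext p
  refine Fin.addCases (fun i' => ?_) (fun j => ?_) p
  · simp only [Fin.append_left, Pi.single_apply, Fin.castAdd_inj]
  · simp only [Fin.append_right, Pi.zero_apply, Pi.single_apply, if_neg (natAdd_ne_castAdd i j)]

/-- A second-copy direction: `Fin.append 0 (e_j ⊗ u) = e_{natAdd j} ⊗ u`. [folklore] -/
theorem append_zero_single (j : Fin n₂) (u : Space) :
    Fin.append (0 : Config n₁) (Pi.single j u) = (Pi.single (Fin.natAdd n₁ j) u : Config (n₁ + n₂)) := by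
  funext p
  refine Fin.addCases (fun i => ?_) (fun j' => ?_) p
  · simp only [Fin.append_left, Pi.zero_apply, Pi.single_apply, if_neg (natAdd_ne_castAdd i j).symm]
  · simp only [Fin.append_right, Pi.single_apply, Fin.natAdd_inj]

/-- Translating a first-copy particle: `Fin.append (X + e_i ⊗ u) Y = Fin.append X Y + e_{castAdd i} ⊗ u`. [folklore] -/
theorem append_add_single_left (X : Config n₁) (Y : Config n₂) (i : Fin n₁) (u : Space) :
    Fin.append (X + Pi.single i u) Y = Fin.append X Y + Pi.single (Fin.castAdd n₂ i) u := by
  rw [← append_single_zero, ← append_add, add_zero]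

/-- Translating a second-copy particle: `Fin.append X (Y + e_j ⊗ u) = Fin.append X Y + e_{natAdd j} ⊗ u`. [folklore] -/
theorem append_add_single_right (X : Config n₁) (Y : Config n₂) (j : Fin n₂) (u : Space) :
    Fin.append X (Y + Pi.single j u) = Fin.append X Y + Pi.single (Fin.natAdd n₁ j) u := by
  rw [← append_zero_single (n₁ := n₁), ← append_add, add_zero]

/-! #### `ψ ∘ Fin.append`: smoothness and the kinetic density (chain rule) -/

/-- `(X, Y) ↦ ψ (Fin.append X Y)` is `C¹` if `ψ` is. [folklore] -/
theorem contDiff_append {ψ : Config (n₁ + n₂) → ℂ} (hψ : ContDiff ℝ 1 ψ) :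
    ContDiff ℝ 1 fun Z : Config n₁ × Config n₂ => ψ (Fin.append Z.1 Z.2) := by
  obtain ⟨A, hA⟩ := exists_appendCLM n₁ n₂
  rw [comp_append_eq hA]
  exact hψ.comp A.contDiff

section Slices

variable {E₁ E₂ F G : Type*} [NormedAddCommGroup E₁] [NormedSpace ℝ E₁] [NormedAddCommGroup E₂]
  [NormedSpace ℝ E₂] [NormedAddCommGroup F] [NormedSpace ℝ F] [NormedAddCommGroup G] [NormedSpace ℝ G]

/-- `∂_d [X ↦ ψ (A (X, Y))] = Dψ (A (X, Y)) (A (d, 0))` for a continuous linear `A : E₁ × E₂ → F`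
(chain rule; `SwapInvariance.fderiv_slice_fst_comp` with a general target). [folklore] -/
theorem fderiv_slice_fst_clm (A : (E₁ × E₂) →L[ℝ] F) {ψ : F → G} (hψ : Differentiable ℝ ψ) (X : E₁) (Y : E₂)
    (d : E₁) : fderiv ℝ (fun X => ψ (A (X, Y))) X d = fderiv ℝ ψ (A (X, Y)) (A (d, 0)) := by
  have h : HasFDerivAt (fun X => ψ (A (X, Y)))
      ((fderiv ℝ ψ (A (X, Y))).comp (A.comp (ContinuousLinearMap.inl ℝ E₁ E₂))) X :=
    (hψ (A (X, Y))).hasFDerivAt.comp X (A.hasFDerivAt.comp X (hasFDerivAt_prodMk_left X Y))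
  rw [h.fderiv, ContinuousLinearMap.coe_comp, Function.comp_apply, ContinuousLinearMap.coe_comp,
    Function.comp_apply, ContinuousLinearMap.inl_apply]

/-- `∂_d [Y ↦ ψ (A (X, Y))] = Dψ (A (X, Y)) (A (0, d))` for a continuous linear `A : E₁ × E₂ → F`. [folklore] -/
theorem fderiv_slice_snd_clm (A : (E₁ × E₂) →L[ℝ] F) {ψ : F → G} (hψ : Differentiable ℝ ψ) (X : E₁) (Y : E₂)
    (d : E₂) : fderiv ℝ (fun Y => ψ (A (X, Y))) Y d = fderiv ℝ ψ (A (X, Y)) (A (0, d)) := by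
  have h : HasFDerivAt (fun Y => ψ (A (X, Y)))
      ((fderiv ℝ ψ (A (X, Y))).comp (A.comp (ContinuousLinearMap.inr ℝ E₁ E₂))) Y :=
    (hψ (A (X, Y))).hasFDerivAt.comp Y (A.hasFDerivAt.comp Y (hasFDerivAt_prodMk_right X Y))
  rw [h.fderiv, ContinuousLinearMap.coe_comp, Function.comp_apply, ContinuousLinearMap.coe_comp,
    Function.comp_apply, ContinuousLinearMap.inr_apply]

end Slices

/-- `∂_d [X ↦ ψ (Fin.append X Y)] = Dψ (Fin.append X Y) (Fin.append d 0)`. [folklore] -/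
theorem fderiv_append_fst {ψ : Config (n₁ + n₂) → ℂ} (hψ : Differentiable ℝ ψ) (X : Config n₁) (Y : Config n₂)
    (d : Config n₁) :
    fderiv ℝ (fun X' => ψ (Fin.append X' Y)) X d = fderiv ℝ ψ (Fin.append X Y) (Fin.append d 0) := by
  obtain ⟨A, hA⟩ := exists_appendCLM n₁ n₂
  have h := fderiv_slice_fst_clm A hψ X Y d
  simp only [hA] at h
  exact h

/-- `∂_d [Y ↦ ψ (Fin.append X Y)] = Dψ (Fin.append X Y) (Fin.append 0 d)`. [folklore] -/
theorem fderiv_append_snd {ψ : Config (n₁ + n₂) → ℂ} (hψ : Differentiable ℝ ψ) (X : Config n₁) (Y : Config n₂)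
    (d : Config n₂) :
    fderiv ℝ (fun Y' => ψ (Fin.append X Y')) Y d = fderiv ℝ ψ (Fin.append X Y) (Fin.append 0 d) := by
  obtain ⟨A, hA⟩ := exists_appendCLM n₁ n₂
  have h := fderiv_slice_snd_clm A hψ X Y d
  simp only [hA] at h
  exact h

/-- **The two-copy kinetic density of `ψ ∘ Fin.append` at `(X, Y)` is the full kinetic density of `ψ` at
`Fin.append X Y`**: the first-copy directions are the directions `castAdd i`, the second-copy ones the
directions `natAdd j`, and `∑_{Fin (n₁+n₂)} = ∑_{castAdd} + ∑_{natAdd}`. [folklore] -/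
theorem kinetic_append {ψ : Config (n₁ + n₂) → ℂ} (hψ : Differentiable ℝ ψ) (X : Config n₁) (Y : Config n₂) :
    kineticDensity (fun X' => ψ (Fin.append X' Y)) X + kineticDensity (fun Y' => ψ (Fin.append X Y')) Y =
      kineticDensity ψ (Fin.append X Y) := by
  rw [kineticDensity_eq_kineticOn_add ψ]
  unfold kineticDensity kineticOn
  congr 1
  · refine Finset.sum_congr rfl fun i _ => Finset.sum_congr rfl fun k _ => ?_
    rw [fderiv_append_fst hψ, append_single_zero]
  · refine Finset.sum_congr rfl fun j _ => Finset.sum_congr rfl fun k _ => ?_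
    rw [fderiv_append_snd hψ, append_zero_single]

/-! #### The pair interaction of the juxtaposed configuration -/

/-- **Splitting the pair sum of `Fin.append X Y`**: pairs inside `X`, pairs inside `Y`, and all cross pairs,
`∑_{p<q} v^per(W_p - W_q) = ∑_{i<i'} v^per(X_i - X_{i'}) + ∑_{j<j'} v^per(Y_j - Y_{j'}) + ∑_{i,j} v^per(X_i - Y_j)`.
[folklore] -/
theorem periodicInteraction_append (v : ℝ → ℝ≥0∞) (L : ℝ) (X : Config n₁) (Y : Config n₂) :
    periodicInteraction v L (Fin.append X Y) = periodicInteraction v L X + periodicInteraction v L Y +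
      ∑ i : Fin n₁, ∑ j : Fin n₂, periodizedPotential v L (X i - Y j) := by
  unfold periodicInteraction
  simp only [Finset.sum_filter, Fin.sum_univ_add, Fin.append_left, Fin.append_right,
    (Fin.strictMono_castAdd n₂).lt_iff_lt, (Fin.strictMono_natAdd n₁).lt_iff_lt, castAdd_lt_natAdd,
    if_true, not_natAdd_lt_castAdd, if_false, Finset.sum_add_distrib, Finset.sum_const_zero, add_zero]
  ring

/-- The uncoupled weight is a sub-sum: `∑_{i<i'} v^per(X_i - X_{i'}) + ∑_{j<j'} v^per(Y_j - Y_{j'}) ≤ ∑_{p<q} v^per(W_p - W_q)`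
for `W = Fin.append X Y`. [folklore] -/
theorem weightZero_le (v : ℝ → ℝ≥0∞) (L : ℝ) (X : Config n₁) (Y : Config n₂) :
    periodicInteraction v L X + periodicInteraction v L Y ≤ periodicInteraction v L (Fin.append X Y) := by
  rw [periodicInteraction_append]
  exact le_self_add

/-- `½ t ≤ t` in `ℝ≥0∞`. [folklore] -/
theorem two_inv_mul_le (t : ℝ≥0∞) : (2 : ℝ≥0∞)⁻¹ * t ≤ t :=
  mul_le_of_le_one_left' (ENNReal.inv_le_one.2 one_le_two)

/-- The tagged–bath cross pairs `(0, j+1)` and `(j+1, 0)` are among all cross pairs (`v^per` even). [folklore] -/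
theorem cross_tagged_le {n : ℕ} (v : ℝ → ℝ≥0∞) (L : ℝ) (X Y : Config (n + 1)) :
    ∑ j : Fin n, periodizedPotential v L (X 0 - Y j.succ) + ∑ j : Fin n, periodizedPotential v L (Y 0 - X j.succ) ≤
      ∑ i : Fin (n + 1), ∑ j : Fin (n + 1), periodizedPotential v L (X i - Y j) := by
  rw [Fin.sum_univ_succ]
  refine add_le_add ?_ (Finset.sum_le_sum fun i _ => ?_)
  · rw [Fin.sum_univ_succ]
    exact le_add_self
  · rw [Fin.sum_univ_succ, periodizedPotential_sub_comm]
    exact le_self_add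

/-- **The half-swapped weight is a sub-sum of the full pair interaction of `Fin.append X Y`**: the bath–bath
pairs of each copy, the tagged–own-bath pairs at strength `½ ≤ 1`, and the tagged–other-bath cross pairs at
strength `½ ≤ 1`. [folklore] -/
theorem weightHalf_le {n : ℕ} (v : ℝ → ℝ≥0∞) (L : ℝ) (X Y : Config (n + 1)) :
    periodicInteraction v L (Fin.tail X) + periodicInteraction v L (Fin.tail Y) +
        ∑ j : Fin n, (2 : ENNReal)⁻¹ * (periodizedPotential v L (X 0 - X j.succ) +
          periodizedPotential v L (Y 0 - Y j.succ) + periodizedPotential v L (Y 0 - X j.succ) +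
          periodizedPotential v L (X 0 - Y j.succ)) ≤
      periodicInteraction v L (Fin.append X Y) := by
  rw [periodicInteraction_append, periodicInteraction_succ v L X, periodicInteraction_succ v L Y,
    show Matrix.vecTail X = Fin.tail X from rfl, show Matrix.vecTail Y = Fin.tail Y from rfl]
  calc periodicInteraction v L (Fin.tail X) + periodicInteraction v L (Fin.tail Y) +
        ∑ j : Fin n, (2 : ENNReal)⁻¹ * (periodizedPotential v L (X 0 - X j.succ) +
          periodizedPotential v L (Y 0 - Y j.succ) + periodizedPotential v L (Y 0 - X j.succ) +
          periodizedPotential v L (X 0 - Y j.succ))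
      ≤ periodicInteraction v L (Fin.tail X) + periodicInteraction v L (Fin.tail Y) +
        ∑ j : Fin n, (periodizedPotential v L (X 0 - X j.succ) +
          periodizedPotential v L (Y 0 - Y j.succ) + periodizedPotential v L (Y 0 - X j.succ) +
          periodizedPotential v L (X 0 - Y j.succ)) := by
        gcongr with j _
        exact two_inv_mul_le _
    _ = (∑ j : Fin n, periodizedPotential v L (X 0 - X j.succ) + periodicInteraction v L (Fin.tail X)) +
          (∑ j : Fin n, periodizedPotential v L (Y 0 - Y j.succ) + periodicInteraction v L (Fin.tail Y)) +
        (∑ j : Fin n, periodizedPotential v L (X 0 - Y j.succ) +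
          ∑ j : Fin n, periodizedPotential v L (Y 0 - X j.succ)) := by
        simp only [Finset.sum_add_distrib]
        ring
    _ ≤ _ := add_le_add le_rfl (cross_tagged_le v L X Y)

/-! #### Change of variables `(X, Y) ↦ Fin.append X Y` -/

/-- The inverse of the splitting `splitConfig` is juxtaposition. [folklore] -/
theorem splitConfig_symm_apply (Z : Config n₁ × Config n₂) : (splitConfig n₁ n₂).symm Z = Fin.append Z.1 Z.2 := by
  apply (splitConfig n₁ n₂).injective
  rw [MeasurableEquiv.apply_symm_apply]
  refine Prod.ext (funext fun i => ?_) (funext fun j => ?_)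
  · rw [splitConfig_apply_fst, Fin.append_left]
  · rw [splitConfig_apply_snd, Fin.append_right]

/-- Juxtaposition pulls the `(n₁+n₂)`-particle cell back to the product of the cells. [folklore] -/
theorem append_preimage_cellN (L : ℝ) :
    (splitConfig n₁ n₂).symm ⁻¹' cellN (n₁ + n₂) L = cellN n₁ L ×ˢ cellN n₂ L := by
  ext Z
  simp only [Set.mem_preimage, splitConfig_symm_apply, cellN, Set.mem_setOf_eq, Set.mem_prod, Fin.forall_fin_add,
    Fin.append_left, Fin.append_right]

/-- **Change of variables under juxtaposition**: `(X, Y) ↦ Fin.append X Y` is a measure-preserving measurable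
equivalence mapping `cellN n₁ L ×ˢ cellN n₂ L` onto `cellN (n₁+n₂) L`, so
`∫_{cell × cell} g (Fin.append X Y) = ∫_{cell} g`. [folklore] -/
theorem setLIntegral_comp_append (n₁ n₂ : ℕ) (L : ℝ) (g : Config (n₁ + n₂) → ℝ≥0∞) :
    ∫⁻ Z in cellN n₁ L ×ˢ cellN n₂ L, g (Fin.append Z.1 Z.2) = ∫⁻ W in cellN (n₁ + n₂) L, g W := by
  have hmp : MeasurePreserving (splitConfig n₁ n₂).symm volume volume := (volume_preserving_splitConfig n₁ n₂).symm
  have key := hmp.setLIntegral_comp_preimage_emb (splitConfig n₁ n₂).symm.measurableEmbedding g (cellN (n₁ + n₂) L)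
  rw [append_preimage_cellN] at key
  simp only [splitConfig_symm_apply] at key
  exact key

end AppendEmbedding

open AppendEmbedding

/-! ### The registered stub -/

/-- S5a — `stub_appendEmbedding` (M/L, fixed `n`; worker): the `Fin.append` embedding of a `2(n+1)`-particle periodic trial
state is absolutely admissible with two-copy energies below its periodic energy. -/
theorem stub_appendEmbedding :
    ∀ v : ℝ → ℝ≥0∞, IsRepulsiveFiniteRange v → ∀ (n : ℕ) (L : ℝ) (Ξ : PeriodicTrialState ((n + 1) + (n + 1)) L),
      let C2 : Set (Config (n + 1) × Config (n + 1)) := (cellN (n + 1) L) ×ˢ (cellN (n + 1) L)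
      let E2z : (Config (n + 1) × Config (n + 1) → ℂ) → ℝ≥0∞ := fun Θ => ∫⁻ Z in C2,
        kineticDensity (fun X => Θ (X, Z.2)) Z.1 + kineticDensity (fun Y => Θ (Z.1, Y)) Z.2 +
          (periodicInteraction v L Z.1 + periodicInteraction v L Z.2) * (‖Θ Z‖₊ : ENNReal) ^ 2
      let E2h : (Config (n + 1) × Config (n + 1) → ℂ) → ℝ≥0∞ := fun Θ => ∫⁻ Z in C2,
        (kineticDensity (fun X => Θ (X, Z.2)) Z.1 + kineticDensity (fun Y => Θ (Z.1, Y)) Z.2 +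
          (periodicInteraction v L (Fin.tail Z.1) + periodicInteraction v L (Fin.tail Z.2) +
            ∑ j : Fin n, (2 : ENNReal)⁻¹ * (periodizedPotential v L (Z.1 0 - Z.1 j.succ) +
              periodizedPotential v L (Z.2 0 - Z.2 j.succ) + periodizedPotential v L (Z.2 0 - Z.1 j.succ) +
              periodizedPotential v L (Z.1 0 - Z.2 j.succ))) * (‖Θ Z‖₊ : ENNReal) ^ 2)
      let Adm : (Config (n + 1) × Config (n + 1) → ℂ) → Prop := fun Θ => ContDiff ℝ 1 Θ ∧
        (∀ (Z : Config (n + 1) × Config (n + 1)) (i : Fin (n + 1)) (k : Fin 3),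
          Θ (Z.1 + Pi.single i (EuclideanSpace.single k L), Z.2) = Θ Z ∧
            Θ (Z.1, Z.2 + Pi.single i (EuclideanSpace.single k L)) = Θ Z) ∧
        ∫⁻ Z in C2, (‖Θ Z‖₊ : ENNReal) ^ 2 = 1
      let Θ : Config (n + 1) × Config (n + 1) → ℂ := fun Z => Ξ.ψ (Fin.append Z.1 Z.2)
      Adm Θ ∧ E2h Θ ≤ periodicEnergy v Ξ ∧ E2z Θ ≤ periodicEnergy v Ξ := by
  intro v _hv n L Ξ
  dsimp only
  have hdiff : Differentiable ℝ Ξ.ψ := Ξ.contDiff.differentiable one_ne_zero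
  have hE : ∫⁻ Z in cellN (n + 1) L ×ˢ cellN (n + 1) L, (kineticDensity Ξ.ψ (Fin.append Z.1 Z.2) +
      periodicInteraction v L (Fin.append Z.1 Z.2) * (‖Ξ.ψ (Fin.append Z.1 Z.2)‖₊ : ENNReal) ^ 2) =
      periodicEnergy v Ξ :=
    setLIntegral_comp_append (n + 1) (n + 1) L fun W =>
      kineticDensity Ξ.ψ W + periodicInteraction v L W * (‖Ξ.ψ W‖₊ : ENNReal) ^ 2
  refine ⟨⟨contDiff_append Ξ.contDiff, fun Z i k => ⟨?_, ?_⟩, ?_⟩, ?_, ?_⟩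
  · rw [append_add_single_left]
    exact Ξ.periodic _ _ k
  · rw [append_add_single_right]
    exact Ξ.periodic _ _ k
  · exact (setLIntegral_comp_append (n + 1) (n + 1) L fun W => (‖Ξ.ψ W‖₊ : ENNReal) ^ 2).trans Ξ.norm_eq
  · rw [← hE]
    exact lintegral_mono fun Z => add_le_add (kinetic_append hdiff Z.1 Z.2).le
      (mul_le_mul_left (weightHalf_le v L Z.1 Z.2) _)
  · rw [← hE]
    exact lintegral_mono fun Z => add_le_add (kinetic_append hdiff Z.1 Z.2).le
      (mul_le_mul_left (weightZero_le v L Z.1 Z.2) _)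

end Summit.AtomisticToContinuum.BoseEinsteinCondensation.Cruxes.TorusHalfSwapOverlap.Birth

end
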